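import Summits.QuantumFields.YangMills.Theorems.BalabanUVNodesN06AtRecord11ObligationsPins
import Summits.QuantumFields.YangMills.Theorems.BalabanUVNodesN06AtRecord11ObligationsHg
import Summits.QuantumFields.YangMills.Theorems.BalabanUVNodesN06SectBOfFrameV4
import Literature.MathematicalPhysics.QuantumFieldTheory.Balaban1983to89.B9Cor35ComparisonsEH
import Literature.MathematicalPhysics.QuantumFieldTheory.Balaban1983to89.B9Ineq344LocalPairHolds
import Literature.MathematicalPhysics.QuantumFieldTheory.Balaban1983to89.B9Ineq347GAAtLetters
import Literature.MathematicalPhysics.QuantumFieldTheory.Balaban1983to89.B9Thm39ReadingAtLetters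
import Literature.MathematicalPhysics.QuantumFieldTheory.Balaban1983to89.B9Thm314Thm315RecordVacuity
import Literature.MathematicalPhysics.QuantumFieldTheory.Balaban1983to89.Node00.OpsYSectDE
import Literature.MathematicalPhysics.QuantumFieldTheory.Balaban1983to89.B9Thm312WholeLeafRelH
import Literature.MathematicalPhysics.QuantumFieldTheory.Balaban1983to89.B9Thm313WholeLeafRel
import Literature.MathematicalPhysics.QuantumFieldTheory.Balaban1983to89.B9Thm312WholeFacesY
import Literature.MathematicalPhysics.QuantumFieldTheory.Balaban1983to89.B9CarrierBlockMultiplicity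
import Literature.MathematicalPhysics.QuantumFieldTheory.Balaban1983to89.B9CoRealizesRelAtLetters
import Literature.MathematicalPhysics.QuantumFieldTheory.Balaban1983to89.B9Ineq349SiteReading
import Literature.MathematicalPhysics.QuantumFieldTheory.Balaban1983to89.B9Eq3132AtRecordDE
import Literature.MathematicalPhysics.QuantumFieldTheory.Balaban1983to89.B9Thm314Thm315RecordDE
import Literature.MathematicalPhysics.QuantumFieldTheory.Balaban1983to89.B9Thm311ReadingAtLetters
import Literature.MathematicalPhysics.QuantumFieldTheory.Balaban1983to89.B9RWSumsDefinitePinsPairM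
import Literature.MathematicalPhysics.QuantumFieldTheory.Balaban1983to89.B9Thm311SymmAtRecordV4
import Summits.QuantumFields.YangMills.Theorems.BalabanUVNodesN06CoReadingsOfPins
import Literature.MathematicalPhysics.QuantumFieldTheory.Balaban1983to89.B9Eq3132NuReading
import Literature.MathematicalPhysics.QuantumFieldTheory.Balaban1983to89.B9GeoNbrCountKLevelV1
import Literature.MathematicalPhysics.QuantumFieldTheory.Balaban1983to89.Node00.OpsYSectEElim
import Literature.MathematicalPhysics.QuantumFieldTheory.Balaban1983to89.B9Thm311PosAtRecordV4
import Literature.MathematicalPhysics.QuantumFieldTheory.Balaban1983to89.B9CoReadingCoordsH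
import Literature.MathematicalPhysics.QuantumFieldTheory.Balaban1983to89.B9Ineq349SiteFromBlocks
import Literature.MathematicalPhysics.QuantumFieldTheory.Balaban1983to89.Node00.OpsYRecordV4
import Literature.MathematicalPhysics.QuantumFieldTheory.Balaban1983to89.B9Thm315WholeSectERepOn
import Literature.MathematicalPhysics.QuantumFieldTheory.Balaban1983to89.B9CoReadingCoordsTranspose
import Literature.MathematicalPhysics.QuantumFieldTheory.Balaban1983to89.B9CoReadingCoordsL2Pair
import Literature.MathematicalPhysics.QuantumFieldTheory.Balaban1983to89.B9CoReadingCoordsL2S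
import Literature.MathematicalPhysics.QuantumFieldTheory.Balaban1983to89.B9Thm312WholeLeafCompletePairMBZ
import Literature.MathematicalPhysics.QuantumFieldTheory.Balaban1983to89.B9RWSumsCompleteGeo9YNbr
import Literature.MathematicalPhysics.QuantumFieldTheory.Balaban1983to89.B9Thm313WholeLeafCompletePairMBCZCut
import Literature.MathematicalPhysics.QuantumFieldTheory.Balaban1983to89.Node00.OpsYRecordV4P

/-!
# BalabanUVNodes ∕ N06 ([B9], `Dag.B9_main`) — ROWS 20–21 (THEOREMS 3.12–3.13) AT THE PRINT-UNITS INSTANCE `opsYNuOfRecordV4PE` WITH ROW 21 ON n06-l's LETTERS-SPECIES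
# RE-CUT LEAF `thm313Printed_completePairMBCZc` (the (3.152)–(3.153) letters cut to PRINT'S SPECIES: `Letters313Zc ∕ Letters313HZc ∕ Letters313L2Pc`, no `rgd1 ∕ gD1 ∕ pXDv ∕
# ddGDv ∕ rgdDds`; new free data `Gp` (the G′ letter), `bXH` (the class of G₁∇*_U), new displayed identity (3.152) `Ids3152`) — the cut twin of `…PairMBCZP.t312_t313_of_pins_pairMBCZ_phys` (p598013)

Track A of `YM-PLAN.md` (cell `pub-ymgap`, HUMAN RULING D-0062), node **N06** = [Balaban1985BackgroundPropagators] Thms 3.1–3.15; seat `pub-ymgap-dag-n06-d` gen 12.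

THE POINT (cell `pub/ym-inputs` memos `LETTERS-313-LOCATE-p04.md` ∕ `RECUT-BILL-L0-DESIGN-p04.md`, ★★OWNER `ym3-torus-plan` WANTED №g26-7, letter owner dag-n06-l g19).  Three displayed
fields of the rows-20–21 schemas of record are typed BEYOND print's species and have no member-uniform supplier at genuine operators — `Letters313Z.rgd1` (R·D\*·G₁·∇\*_U between pure
sharp-block sup classes; Calderón–Zygmund endpoint, constant ≳ 0.64·j·ln L at a level-j member) and `Letters313L2PZ.ddGDv ∕ rgdDds` (net derivative order +1 in plain block-L², constant ≳ Lʲ).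
Print's own reduction (re-associating (3.153)'s middle term with (3.152)) needs none of them; dag-n06-l's cut leaf `B9Thm313WholeLeafCompletePairMBCZCut.thm313Printed_completePairMBCZc`
(landed 2026-08-28) takes `hletters : … Letters313Zc (𝔬 i) (Gp i) … (bXH i) U` (NO `gD1 ∕ rgd1`; NEW `gXH` = G₁∇\*_U : Y⁰ → `bXH`, `wGp` = D·G′·R·D\* : `bXH` → 𝔠⁽¹⁾), `hLH3 : … Letters313HZc …
(bXH i) U` (NO `pXDv`; NEW `pWE β` = Φ^X_β∘(D·G′·R·D\*)), `hLL2 : … Letters313L2Pc … ∧ Letters313L2MZ …` (NO `ddGDv ∕ rgdDds`; NEW `vDRDG ∕ vGDRD`), new data `Gp bXH`, `hκX`, and ONE new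
displayed row `h152 : … Ids3152 (𝔬 i) (Gp i) U` (the identity (3.152) `RD\*G₁ = RG′D\*`, `G₁DR = DG′R`); conclusion `B9.Thm313Printed …` BYTE-IDENTICAL.  THIS FILE is p598013 VERBATIM with
row 21 on that leaf: ★★ `t312_t313_of_pins_pairMBCZc_phys` — binders as in p598013 except `hletters13 : … Letters313Zc (𝔬12 x) (Gp x) … (bXH x) U`, `hLH3 : … Letters313HZc (𝔬12 x) (𝔭A x) (Gp x) …
(bXH x) U`, `hLL2 : … Letters313L2Pc … ∧ Letters313L2MZ …`, NEW `Gp bXH hκX` (after `hκW13`) and `h152` (after `hletters13`); row 20 (`thm312Printed_completePairMBZ`) and every other binder ∕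
proof line UNCHANGED (the certificate keeps `Letters313HZ` displayed for the rows-20–21 STEP engine, which reads `pXDv ∕ pYDH`, and hands this file `Letters313HZc.of_HZ (hLH3 …) (hWE …)`).
STILL DISPLAYED (hypotheses, the node's content for these rows): the walk letters, the numerics, the printed-shape schemas `hmodel12 hleft12 hlettersH12 hG0C hstepC hLHH hLH3 hLL2 hLIM
hletters13 h152 hlettersD13` — now ALL of printed species —, the pair-family co-readings `hH1N hIF hHCN`, `hsymD`, the predicate pins and the coordinate pins.
HONEST FRAMING.  COUNT-NEUTRAL; nothing of [B9] asserted; N06 NOT discharged; kernel bookkeeping (a leaf swap); old-reader instance (FLAG №8 column note applies).  One finite 𝕋⁴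
programme at fixed `ε` — NOT continuum, NOT OS, NOT the mass gap ∕ Clay.  0 `def`, 0 `sorry`.
-/

noncomputable section

namespace Summit.QuantumFields.YangMills.BalabanUVNodes.N06Thm312313AtPinsPairMBCZcP


open Literature.MathematicalPhysics.QuantumFieldTheory.Balaban1983to89 open Literature.MathematicalPhysics.QuantumFieldTheory.Balaban1983to89.T4Continuum (T4Family) open Literature.MathematicalPhysics.QuantumFieldTheory.Balaban1983to89.DagBinding (WorldP leavesP) open Literature.MathematicalPhysics.QuantumFieldTheory.Balaban1983to89.Node00 open Literature.MathematicalPhysics.QuantumFieldTheory.Balaban1983to89.B9PinMembersKLevelV1 (MemberY geo9Y bg9Y) open Literature.MathematicalPhysics.QuantumFieldTheory.Balaban1983to89.B9PinGeometryKLevelV1 (dOmegaY OmKY inΛY unitDistY InCubeY c35Y c35Y_pos) open Literature.MathematicalPhysics.QuantumFieldTheory.Balaban1983to89.B7Prop2SpecialUnitary (specialUnitaryUnits specialUnitaryUnits_le_unitaryUnits) open Literature.MathematicalPhysics.QuantumFieldTheory.Balaban1983to89.B9Ineq347GAAtLetters (hGA_opsYOfLetters) open Literature.MathematicalPhysics.QuantumFieldTheory.Balaban1983to89.B9Ineq344LocalPairHolds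 (hGp_opsYOfLetters_holds) open Literature.MathematicalPhysics.QuantumFieldTheory.Balaban1983to89.B9Cor35ComparisonsGAAtLetters
  (hGA_e_opsYOfLetters hGA_h1_opsYOfLetters hGA_e4_opsYOfLetters hGA_h2_opsYOfLetters hGA_l2_opsYOfLetters)
open Literature.MathematicalPhysics.QuantumFieldTheory.Balaban1983to89.B9Cor35ComparisonsGpCAtLetters (hGp_e_opsYOfLetters hGp_h1_opsYOfLetters hC_opsYOfLetters) open Literature.MathematicalPhysics.QuantumFieldTheory.Balaban1983to89.B9Cor35ComparisonsEH (hE4_of_hGA_e4 hH2_of_hGA_h2) open Literature.MathematicalPhysics.QuantumFieldTheory.Balaban1983to89.B9Thm314Thm315RecordVacuity (thm315FullPrinted_of_ker_zero) open Literature.MathematicalPhysics.QuantumFieldTheory.Balaban1983to89.B9RecordDELettersVacuity (siteKernelOfOp_zero_ker fineKernelOfOp_zero_ker stmt349Printed_of_ker_zero) open Literature.MathematicalPhysics.QuantumFieldTheory.Balaban1983to89.B9GeoLemma21KLevelV1 (geo9Y_len_pos) open Literature.MathematicalPhysics.QuantumFieldTheory.Balaban1983to89.B9Thm311Whole (PosDefOfOps)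 open Literature.MathematicalPhysics.QuantumFieldTheory.Balaban1983to89.B9Thm39Whole (WalkReading39) open Literature.MathematicalPhysics.QuantumFieldTheory.Balaban1983to89.B9Thm39WholeBlk (Ops39Blk StaticOK39Blk Locality39Blk Local348Blk Identities395Blk Small285Blk Factors389Blk)
open Literature.MathematicalPhysics.QuantumFieldTheory.Balaban1983to89.B9Thm39WholeBlkViaDatum (EK39OfOpsBlkVia) open Literature.MathematicalPhysics.QuantumFieldTheory.Balaban1983to89.B9Thm39ReadingCoords (repSite39) open Literature.MathematicalPhysics.QuantumFieldTheory.Balaban1983to89.B9Thm39ReadingAtLetters (X39 blk39 L39 t39_hksum_of_pins_opsYOfLetters) open Literature.MathematicalPhysics.QuantumFieldTheory.Balaban1983to89.B9RowSum261DefiniteFaces (rowConst261) open Summit.QuantumFields.YangMills.BalabanUVNodes.N06AtRecord11ObligationsPins (t311_of_pin) open Summit.QuantumFields.YangMills.BalabanUVNodes.N06AtRecord11ObligationsHg (hg_obligation_vacuous) open Summit.QuantumFields.YangMills.BalabanUVNodes.N06AtRecord11CB10YZW (b9_main_of_up_view₁₁B10YZW_of_obligations) open Literature.MathematicalPhysics.QuantumFieldTheory.Balaban1983to89.B9Thm312Whole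 (GeoOK Thm33G0 FormSmall HasRWExpOfOps HasRWExpHOfOps PosDefKOfOps) open Literature.MathematicalPhysics.QuantumFieldTheory.Balaban1983to89.B11SectG (RowSum BlockNorm) open Literature.MathematicalPhysics.QuantumFieldTheory.Balaban1983to89.B9FromB6 (L2Block) open Literature.MathematicalPhysics.QuantumFieldTheory.Balaban1983to89.B9Thm312WholeH (LettersH) open Literature.MathematicalPhysics.QuantumFieldTheory.Balaban1983to89.B9Thm312WholeLeft (LeftStep)
open Literature.MathematicalPhysics.QuantumFieldTheory.Balaban1983to89.B9Thm313WholeLeft (Letters313D) open Literature.MathematicalPhysics.QuantumFieldTheory.Balaban1983to89.B9Thm313Whole (Letters313) open Literature.MathematicalPhysics.QuantumFieldTheory.Balaban1983to89.B9Ineq347CoReading (CoReadsGlob) open Literature.MathematicalPhysics.QuantumFieldTheory.Balaban1983to89.B9Thm312WholeFacesY (lemma21AboveG_geo9Y) open Literature.MathematicalPhysics.QuantumFieldTheory.Balaban1983to89.B9GeoNormsKLevelV1 (geo9K_dist_nonneg) open Literature.MathematicalPhysics.QuantumFieldTheory.Balaban1983to89.B9GeoLemma21KLevelV1 (distOK_geo9Y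 rowSum261_geo9Y geo9Y_dist_triangle geo9Y_dist_comm) open Literature.MathematicalPhysics.QuantumFieldTheory.Balaban1983to89.B9GeoNormsKLevelModelSignsV1 (modelSignsOn_geo9K) open Literature.MathematicalPhysics.QuantumFieldTheory.Balaban1983to89.B9Thm34Ext (toB6) open Literature.MathematicalPhysics.QuantumFieldTheory.Balaban1983to89.B9CoRealizesRel (CoRealizesRel) open Literature.MathematicalPhysics.QuantumFieldTheory.Balaban1983to89.B9CoRealizesRelAtLetters (RelB maj342_relB_left maj342_relB_right dist_eq_of_relB len_eq_of_relB relB_refl)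
open Literature.MathematicalPhysics.QuantumFieldTheory.Balaban1983to89.B9CoRealizesHRel (CoRealizesHRel) open Literature.MathematicalPhysics.QuantumFieldTheory.Balaban1983to89.B9SectCDiffDict (maj342) open Literature.MathematicalPhysics.QuantumFieldTheory.Balaban1983to89.B6Ineq2142KLevelV1 (β) open Literature.MathematicalPhysics.QuantumFieldTheory.Balaban1983to89.B9CarrierBlockMultiplicity (card_sameCarrier_le_kIdx) open Literature.MathematicalPhysics.QuantumFieldTheory.Balaban1983to89.B9Thm312WholeLeafRelH (thm312Printed_of_stepRelH) open Literature.MathematicalPhysics.QuantumFieldTheory.Balaban1983to89.B9Thm313WholeLeafRel (thm313Printed_of_stepRel) open Literature.MathematicalPhysics.QuantumFieldTheory.Balaban1983to89.B9Eq3132SectDLetters (QGQY) open Literature.MathematicalPhysics.QuantumFieldTheory.Balaban1983to89.B9Eq3132CTInputs (CoerciveUnder DecayUnder) open Literature.MathematicalPhysics.QuantumFieldTheory.Balaban1983to89.B9Eq3132ScalarIndex (geoComap) open Literature.MathematicalPhysics.QuantumFieldTheory.Balaban1983to89.B9Eq3132RingInverseReading (normMatY) open Literature.MathematicalPhysics.QuantumFieldTheory.Balaban1983to89.B9Ineq349SiteReading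 (opsYS349OfRecordDE) open Literature.MathematicalPhysics.QuantumFieldTheory.Balaban1983to89.B9Eq3132AtRecordDE (s3132_opsYOfRecordDE)
open Literature.MathematicalPhysics.QuantumFieldTheory.Balaban1983to89.B9Thm314Thm315RecordDE (thm314_pair_opsYOfRecordDE t315_opsYOfRecordDE_of_slots) open Literature.MathematicalPhysics.QuantumFieldTheory.Balaban1983to89.B9Thm311ReadingAtLetters (ops311Y) open Literature.MathematicalPhysics.QuantumFieldTheory.Balaban1983to89.B9Thm311ReadingCoords (PosDefTr) open Literature.MathematicalPhysics.QuantumFieldTheory.Balaban1983to89.B9Thm311SymmAtRecordV4 (proofLettersOneV4) open Literature.MathematicalPhysics.QuantumFieldTheory.Balaban1983to89.B9Thm311PosAtRecordV4 (t311_of_pins_opsYOfLettersV4₁) open Literature.MathematicalPhysics.QuantumFieldTheory.Balaban1983to89.B9PinGeometryKLevelV1 (kLab) open Literature.MathematicalPhysics.QuantumFieldTheory.Balaban1983to89.B9Thm314GpFlatTorusGeometry (tdistK OmegaC) open Literature.MathematicalPhysics.QuantumFieldTheory.Balaban1983to89.B9Thm314WholePinGeometry (locDataY) open Literature.MathematicalPhysics.QuantumFieldTheory.Balaban1983to89.B9Thm314WholePair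 (locData₂) open Literature.MathematicalPhysics.QuantumFieldTheory.Balaban1983to89.B9Thm314WholePairWalks (pairWalkSets) open Literature.MathematicalPhysics.QuantumFieldTheory.Balaban1983to89.B9Thm314WholeSummation (WalkSetsSpec WalkWeightsSummable) open Literature.MathematicalPhysics.QuantumFieldTheory.Balaban1983to89.B9SectCWalkTermsAllNorms (Thm310AllNormsPrinted) open Literature.MathematicalPhysics.QuantumFieldTheory.Balaban1983to89.B9Thm314WholeExpansionReads (ExpansionReads) open Literature.MathematicalPhysics.QuantumFieldTheory.Balaban1983to89.B9Thm314WholeCancellationLayer (pairOp) open Literature.MathematicalPhysics.QuantumFieldTheory.Balaban1983to89.B9Thm37Whole (Ops Sizes StaticOK Local342 Identities)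
open Literature.MathematicalPhysics.QuantumFieldTheory.Balaban1983to89.B9Cor38Whole (WalkReading Locality) open Literature.MathematicalPhysics.QuantumFieldTheory.Balaban1983to89.B9Thm310Whole (Ops310 WalkReading310 Sizes310 StaticOK310 Locality310 Local342G Identities310) open Literature.MathematicalPhysics.QuantumFieldTheory.Balaban1983to89.B9RWSumsDefinitePins (PinPrims) open Literature.MathematicalPhysics.QuantumFieldTheory.Balaban1983to89.B9RWSumsDefinitePinsPair (PairPrims) open Literature.MathematicalPhysics.QuantumFieldTheory.Balaban1983to89.B9RWSumsDefinitePinsPairM (MixedPrims E37YPairM E310YPairM rows131819_definite_geo9Y_pairM) open Literature.MathematicalPhysics.QuantumFieldTheory.Balaban1983to89.B9RWSums344InputFam (InputReadsFam sliceProbe) open Literature.MathematicalPhysics.QuantumFieldTheory.Balaban1983to89.B9RWSums344InputPair (InputLegsPair37 FactorsInputPair37 DirSupHolder37 InputLegsPair310 FactorsInputPair310 DirSupHolder310) open Literature.MathematicalPhysics.QuantumFieldTheory.Balaban1983to89.B9RWSums346MixedPair (L2MixedLegs37 FactorsL2Mixed37 DirSup37 L2MixedLegs310 FactorsL2Mixed310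 DirSup310) open Literature.MathematicalPhysics.QuantumFieldTheory.Balaban1983to89.B9CoReadingCoordsTranspose (TrIdx trBasis isTransposePair_GcoK_trBasis isTransposePair_DcoK_GcoK_trBasis isTransposePair_GcoS_trBasis isTransposePair_DcoS_GcoS_trBasis) open Literature.MathematicalPhysics.QuantumFieldTheory.Balaban1983to89.B9Thm311SymmAtRecordV4 (symm0_parSymY symmG_parSymY) open Literature.MathematicalPhysics.QuantumFieldTheory.Balaban1983to89.B9Thm311AdjointPairs (GpY_isSymmTr) open Literature.MathematicalPhysics.QuantumFieldTheory.Balaban1983to89.B9RWSums346SecondDiff (familyOp DirOps310 DirTranspose310 L2SecondLegs310 FactorsL2Second310) open Literature.MathematicalPhysics.QuantumFieldTheory.Balaban1983to89.B9RWSums346SecondDiffGp (DirOps37 DirTranspose37 L2SecondLegs37 FactorsL2Second37) open Literature.MathematicalPhysics.QuantumFieldTheory.Balaban1983to89.B9Thm37Glue (IsTransposePair) open Literature.MathematicalPhysics.QuantumFieldTheory.Balaban1983to89.B9RWSums343to347Whole (GlobReads) open Literature.MathematicalPhysics.QuantumFieldTheory.Balaban1983to89.B9RWSumsReadsNbr (nbr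 L2ReadsNbr H1ReadsNbr InputReadsNbr) open Literature.MathematicalPhysics.QuantumFieldTheory.Balaban1983to89.B9RWSums346Two (L2TwoLegs310 FactorsL2_310) open Literature.MathematicalPhysics.QuantumFieldTheory.Balaban1983to89.B9RWSums346TwoGp (L2TwoLegs37 FactorsL2_37) open Literature.MathematicalPhysics.QuantumFieldTheory.Balaban1983to89.B9RWSums344Input (InputLegs310 FactorsInput310)
open Literature.MathematicalPhysics.QuantumFieldTheory.Balaban1983to89.B9RWSums344InputGp (InputLegs37 FactorsInput37) open Literature.MathematicalPhysics.QuantumFieldTheory.Balaban1983to89.B9RWSums343Holder (HolderProbes HolderLegs310 FactorsHolder310) open Literature.MathematicalPhysics.QuantumFieldTheory.Balaban1983to89.B9RWSums343HolderGp (HolderLegs37 HolderV37) open Literature.MathematicalPhysics.QuantumFieldTheory.Balaban1983to89.B9SectBStepFrameV4 (SectBFrame₄) open Summit.QuantumFields.YangMills.BalabanUVNodes.N06SectBOfFrameV4 (hB_obligation_of_sectBFrame₄)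
open Literature.MathematicalPhysics.QuantumFieldTheory.Balaban1983to89.B9CoReadingCoords (XBK evBK blkBK GcoK DcoK DscoK LcoK coordOpK cdBₗ cdsBₗ) open Literature.MathematicalPhysics.QuantumFieldTheory.Balaban1983to89.B9CoReadingCoordsS (XSK evSK blkSK sIK sIK_faithful GcoS DcoS DscoS LcoS) open Literature.MathematicalPhysics.QuantumFieldTheory.Balaban1983to89.B9CoReadingCoordsL2S (sIK_dist_le_one site_l2ReadsNbr012_of_pins site_l2ReadsNbr345_of_pins) open Literature.MathematicalPhysics.QuantumFieldTheory.Balaban1983to89.B9CoReadingCoordsL2Pair (bond_l2ReadsNbr345_of_pins) open Literature.MathematicalPhysics.QuantumFieldTheory.Balaban1983to89.B9Ineq349SiteComposite (cdSL cdsSL) open Literature.MathematicalPhysics.QuantumFieldTheory.Balaban1983to89.B9Thm312WholeLeafCompletePairM (thm312Printed_completePairM) open Literature.MathematicalPhysics.QuantumFieldTheory.Balaban1983to89.B9RWSumsCompleteGeo9YNbr (len_le_of_dist_le_two_geo9Y one_le_L_nat) open Literature.MathematicalPhysics.QuantumFieldTheory.Balaban1983to89.B9Thm312WholeDir (Thm33G0Dir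 Thm33G0L2M StepDir) open Literature.MathematicalPhysics.QuantumFieldTheory.Balaban1983to89.B9Thm312WholeL2 (StepL2) open Literature.MathematicalPhysics.QuantumFieldTheory.Balaban1983to89.B9Thm312WholeHHolder (LettersHH) open Literature.MathematicalPhysics.QuantumFieldTheory.Balaban1983to89.B9Thm312WholeHHolderNbr (CoReadsHHolderNbr) open Literature.MathematicalPhysics.QuantumFieldTheory.Balaban1983to89.B9Thm311ReadingCoords (IsSymmTr) open Summit.QuantumFields.YangMills.BalabanUVNodes.N06CoReadingsOfPins (bond_coReadings3_of_pins bond_coReadingsLap_of_pins site_coReadings4_of_pins bond_l2ReadsNbr3_of_pins) open Literature.MathematicalPhysics.QuantumFieldTheory.Balaban1983to89.B6Geom246MultiLevelTorus (geomT)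
open Literature.MathematicalPhysics.QuantumFieldTheory.Balaban1983to89.B9Eq3132NuReading (opsYS349NuOfLetters lamInvY) open Literature.MathematicalPhysics.QuantumFieldTheory.Balaban1983to89.B9GeoNbrCountKLevelV1 (nbrM₀Y nbrCountY hnbr_two_of_le) open Literature.MathematicalPhysics.QuantumFieldTheory.Balaban1983to89.B9CoReadingCoordsH (XHK blkHK HcoK coRealizesHRel_of_pins)
open Literature.MathematicalPhysics.QuantumFieldTheory.Balaban1983to89.B9Ineq349SiteFromBlocks (Thm31SiteSchemas Thm32BlkSchema stmt349Printed_site_of_blockSchemas) open Literature.MathematicalPhysics.QuantumFieldTheory.Balaban1983to89.B6GlobalChartV1 (blkV1) open Literature.MathematicalPhysics.QuantumFieldTheory.Balaban1983to89.B6Ineq2142KLevelV1 (lvl) open Literature.MathematicalPhysics.QuantumFieldTheory.Balaban1983to89.B9Thm315WholeSectERep (LocalOuterY) open Literature.MathematicalPhysics.QuantumFieldTheory.Balaban1983to89.B9Thm315WholeSectERepOn (DecayMidOnY t315_opsYSectE_of_3185_on) open Literature.MathematicalPhysics.QuantumFieldTheory.Balaban1983to89.B9Thm314WholeCancellationLayer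 (thm314_pair_layerOfLetters) open Literature.MathematicalPhysics.QuantumFieldTheory.Balaban1983to89.B9Thm314WholePinGeometry (locDataY_laws) open Literature.MathematicalPhysics.QuantumFieldTheory.Balaban1983to89.B9PinGeometryKLevelV1 (dOmegaY_nonneg) open scoped Matrix.Norms.L2Operator
open Literature.MathematicalPhysics.QuantumFieldTheory.Balaban1983to89.B9Thm313WholeLeafCompletePairMBCZCut (thm313Printed_completePairMBCZc) open Literature.MathematicalPhysics.QuantumFieldTheory.Balaban1983to89.B9Thm313WholeLettersCut (Letters313Zc Letters313HZc Letters313L2Pc) open Literature.MathematicalPhysics.QuantumFieldTheory.Balaban1983to89.B9Thm313WholeRgdFrom3152 (Ids3152) open Literature.MathematicalPhysics.QuantumFieldTheory.Balaban1983to89.B9Thm313WholeDirInputBC (Letters313IMBC) open Literature.MathematicalPhysics.QuantumFieldTheory.Balaban1983to89.B9Thm313WholeZ (Letters313Z) open Literature.MathematicalPhysics.QuantumFieldTheory.Balaban1983to89.B9Thm313WholeLeftZ (Letters313DZ) open Literature.MathematicalPhysics.QuantumFieldTheory.Balaban1983to89.B9Thm313WholeDirZ (Letters313DMZ) open Literature.MathematicalPhysics.QuantumFieldTheory.Balaban1983to89.B9Thm313WholeHolderZ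 (Letters313HZ) open Literature.MathematicalPhysics.QuantumFieldTheory.Balaban1983to89.B9Thm313WholeL2GPZ (Letters313L2PZ) open Literature.MathematicalPhysics.QuantumFieldTheory.Balaban1983to89.B9Thm313WholeDirL2Z (Letters313L2MZ) open Literature.MathematicalPhysics.QuantumFieldTheory.Balaban1983to89.B9Thm312WholeLeafCompletePairMBZ (thm312Printed_completePairMBZ) open Literature.MathematicalPhysics.QuantumFieldTheory.Balaban1983to89.B9Thm312WholeHZ (LettersHZ LettersHHZ) open Literature.MathematicalPhysics.QuantumFieldTheory.Balaban1983to89.B9SectDSup (weightNorm) open Literature.MathematicalPhysics.QuantumFieldTheory.Balaban1983to89.B9Thm312WholeDirB (StepDirB) open Literature.MathematicalPhysics.QuantumFieldTheory.Balaban1983to89.B9Thm313WholeDirInputB (Letters313IMB) open Literature.MathematicalPhysics.QuantumFieldTheory.Balaban1983to89.B9Thm313WholeDir (Thm33G0DirR Letters313DM Letters313L2M Letters313IM) open Literature.MathematicalPhysics.QuantumFieldTheory.Balaban1983to89.B9Thm313WholeHolder (Letters313H) open Literature.MathematicalPhysics.QuantumFieldTheory.Balaban1983to89.B9Thm313WholeL2GP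 (Letters313L2P)

variable {N : ℕ}

section Pointed

set_option maxHeartbeats 400000 in
set_option synthInstance.maxSize 512 in
/-- ★★ **ROWS 20–21 AT `opsYNuOfRecordV4PE`, ROW 21 ON THE LETTERS-SPECIES CUT LEAF** (module docstring): `B9.Thm312Printed … ∧ B9.Thm313Printed …` for the print-units instance from the
displayed schemas, with `hletters13 ∕ hLH3 ∕ hLL2` valued in n06-l's cut records `Letters313Zc ∕ Letters313HZc ∕ Letters313L2Pc` (no `rgd1 ∕ gD1 ∕ pXDv ∕ ddGDv ∕ rgdDds`), the new data `Gp bXH hκX`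
and the displayed identity (3.152) `h152 : … Ids3152 (𝔬12 x) (Gp x) U`; row 20 = `thm312Printed_completePairMBZ`, row 21 = `thm313Printed_completePairMBCZc`; otherwise p598013 verbatim.
[cite: Balaban1985BackgroundPropagators, Thm 3.12 pp.420–423 + Thm 3.13 p.426 + (3.152)–(3.153) p.426 + (3.42)–(3.47) pp.397–398 + (3.49) p.399; Balaban1984PropagatorsII, (2.51)–(2.56) pp.232–233 + Lemma 2.1 (2.60)–(2.61) p.234] -/
theorem t312_t313_of_pins_pairMBCZc_phys (θ : Stage3Params) (Mstar : ℕ) (𝔯 : ResY N θ Mstar) (𝔢 : SectEY N θ Mstar) (𝔴 : RWEY N θ Mstar) (𝔈 : ExpsY N θ Mstar)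
    [∀ x : MemberY θ.d₆ θ.ℓ₆ θ.hd' θ.hL' θ.b₀ θ.b₁ Mstar, Fintype (geo9Y x).Site] [∀ x : MemberY θ.d₆ θ.ℓ₆ θ.hd' θ.hL' θ.b₀ θ.b₁ Mstar, DecidableEq (geo9Y x).Site] [∀ x : MemberY θ.d₆ θ.ℓ₆ θ.hd' θ.hL' θ.b₀ θ.b₁ Mstar, DecidableRel (RelB x.toKIdx)]
    (bI : ∀ x : MemberY θ.d₆ θ.ℓ₆ θ.hd' θ.hL' θ.b₀ θ.b₁ Mstar, FBondY x.toKIdx → IBondY x.toKIdx)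
    (hβI : ∀ (x : MemberY θ.d₆ θ.ℓ₆ θ.hd' θ.hL' θ.b₀ θ.b₁ Mstar) (f : FBondY x.toKIdx) (c : IBondY x.toKIdx), blkV1 x.hN x.D f = β x.hN x.D x.hk c → β x.hN x.D x.hk (bI x f) = blkV1 x.hN x.D f)
    (hlev : ∀ (x : MemberY θ.d₆ θ.ℓ₆ θ.hd' θ.hL' θ.b₀ θ.b₁ Mstar) (f : FBondY x.toKIdx), lvl x.hN x.D x.hk (bI x f) = (blkV1 x.hN x.D f).1.1)
    (hβ1 : ∀ (x : MemberY θ.d₆ θ.ℓ₆ θ.hd' θ.hL' θ.b₀ θ.b₁ Mstar) (f : FBondY x.toKIdx), (geomT x.D).dist (β x.hN x.D x.hk (bI x f)) (blkV1 x.hN x.D f) ≤ 1)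
    (hM₀ : nbrM₀Y θ.d₆ θ.ℓ₆ θ.hd' θ.hL' θ.b₀ θ.b₁ 2 ≤ Mstar) {PXA PYA : MemberY θ.d₆ θ.ℓ₆ θ.hd' θ.hL' θ.b₀ θ.b₁ Mstar → Type} [∀ x, Fintype (PXA x)] [∀ x, DecidableEq (PXA x)] [∀ x, Fintype (PYA x)] [∀ x, DecidableEq (PYA x)]
    (𝔭A : ∀ x : MemberY θ.d₆ θ.ℓ₆ θ.hd' θ.hL' θ.b₀ θ.b₁ Mstar, HolderProbes (geo9Y x) (bg9Y (Matrix (Fin N) (Fin N) ℂ) (specialUnitaryUnits (Fin N)) x) (XBK (TrIdx N) x.toKIdx) (XBK (TrIdx N) x.toKIdx) (PXA x) (PYA x))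
    -- the single-direction letters ∇_{U,μ} ∕ ∇*_{U,μ} on the bond carrier (in the certificate: `(𝔡A x).Dd ∕ .Dsd` of the Theorem-3.10 letters), PINNED to the coordinate letters
    (Dd Dds : ∀ x : MemberY θ.d₆ θ.ℓ₆ θ.hd' θ.hL' θ.b₀ θ.b₁ Mstar, (bg9Y (Matrix (Fin N) (Fin N) ℂ) (specialUnitaryUnits (Fin N)) x).Cfg → Fin (θ.d₆ + 1) → Module.End ℝ (XBK (TrIdx N) x.toKIdx → ℝ))
    (hDd : ∀ (x : MemberY θ.d₆ θ.ℓ₆ θ.hd' θ.hL' θ.b₀ θ.b₁ Mstar) (U : (bg9Y (Matrix (Fin N) (Fin N) ℂ) (specialUnitaryUnits (Fin N)) x).Cfg), Dd x U = fun μ => coordOpK (trBasis N) (fun _ : Fin (θ.d₆ + 1) => cdBₗ x.toKIdx U μ)) (hDds : ∀ (x : MemberY θ.d₆ θ.ℓ₆ θ.hd' θ.hL' θ.b₀ θ.b₁ Mstar) (U : (bg9Y (Matrix (Fin N) (Fin N) ℂ) (specialUnitaryUnits (Fin N)) x).Cfg), Dds x U = fun μ => coordOpK (trBasis N) (fun _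 : Fin (θ.d₆ + 1) => cdsBₗ x.toKIdx U μ))
    {W12 : MemberY θ.d₆ θ.ℓ₆ θ.hd' θ.hL' θ.b₀ θ.b₁ Mstar → Type} [∀ x, Fintype (W12 x)]
    (𝔬12 : ∀ x : MemberY θ.d₆ θ.ℓ₆ θ.hd' θ.hL' θ.b₀ θ.b₁ Mstar, B9Thm312Whole.Ops (geo9Y x) (bg9Y (Matrix (Fin N) (Fin N) ℂ) (specialUnitaryUnits (Fin N)) x) (XBK (TrIdx N) x.toKIdx) (XBK (TrIdx N) x.toKIdx) (XHK (TrIdx N) x.toKIdx) (W12 x)) (H12 : MemberY θ.d₆ θ.ℓ₆ θ.hd' θ.hL' θ.b₀ θ.b₁ Mstar → Prop)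
    (bH13 : ∀ x : MemberY θ.d₆ θ.ℓ₆ θ.hd' θ.hL' θ.b₀ θ.b₁ Mstar, BlockNorm (toB6 (geo9Y x) 1 (H12 x)) (W12 x → ℝ)) (θ12 θD12 r12 B12₀ δ12₀ δK12 σ12 ρ12 a12 M12 B12₃ δ12₃ ρ13 α12 κ13 : ℝ) (hθ12 : 0 ≤ θ12) (hθD12 : 0 ≤ θD12) (hr12 : 0 ≤ r12)
    -- row 20's Theorem-3.12 leaf in n06-l's PAIR-MB species (`thm312Printed_completePairMB`): NO displayed residual; extra numerics θ₂ B₂ ρ_f, the β-indexed step constant θH, the ε-indexed θI (print: B₀(β), B′₀(ε) pp. 397–398) and the majorant letters Bh Bi Bq Bi2 of (3.43)–(3.45)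
    (θ2₁₂ B12₂ ρf12 : ℝ) (θH12 θI12 Bh12 Bi12 Bq12 : ℝ → ℝ) (Bi2₁₂ : ℝ → ℝ → ℝ) (hθH12 : ∀ β, 0 ≤ β → β < 1 → 0 ≤ θH12 β) (hθI12 : ∀ ε, 0 < ε → 0 ≤ θI12 ε) (hθ2₁₂ : 0 ≤ θ2₁₂) (hB12₂ : 0 ≤ B12₂) (hρf12 : 0 < ρf12) (hρf1 : ρf12 + σ12 ≤ (1 - α12) * ρ12)
    (hρf2 : ρf12 + 2 * σ12 + α12 * ρ12 ≤ ρ12) (hBh12 : ∀ β, 0 ≤ β → β < 1 → 0 ≤ Bh12 β) (hBi12 : ∀ ε, 0 < ε → ε ≤ 1 → 0 ≤ Bi12 ε) (hBi2₁₂ : ∀ ε β, 0 < ε → ε ≤ 1 → 0 ≤ β → β < 1 → 0 ≤ Bi2₁₂ ε β) (hBq12 : ∀ β, 0 ≤ Bq12 β)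
    (bHX12 : ∀ x : MemberY θ.d₆ θ.ℓ₆ θ.hd' θ.hL' θ.b₀ θ.b₁ Mstar, ℝ → BlockNorm (toB6 (geo9Y x) 1 (H12 x)) ((XBK (TrIdx N) x.toKIdx) → ℝ))
    (hB12₀ : 0 ≤ B12₀) (hB12₃ : 0 ≤ B12₃) (hσ12 : 0 < σ12) (hρ12 : 0 < ρ12) (hρS12 : ρ12 ≤ δ12₀) (hρδ12 : ρ12 + σ12 ≤ δK12) (hρ₃12 : ρ12 + σ12 ≤ δ12₃) (ha12 : 0 < a12) (hM12 : 0 < M12) (hα12 : 0 < α12) (hα12' : α12 ≤ 1 / 2)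
    (hκ13 : ∀ x, (bH13 x).κ ≤ κ13) (hρ13 : 0 < ρ13) (hρ13ρ : ρ13 + 5 * σ12 ≤ ρ12) (hσρ13 : 3 * σ12 < (1 - α12) * ρ13)
    -- row 21's Theorem-3.13 leaf in n06-l's PAIR-MB species (`thm313Printed_completePairMB`): NO displayed residual; extra numerics B₄ and the ε-indexed θ_V(ε), B_r(ε), the majorant letters
    -- B_hD B_x B_d B_d2 of (3.152)–(3.153)'s input members, the input norms `bHW13` on the H-carrier `W12`; the rate is (1 − α)ρ′ − 3σ (hence `hρ13ρ`'s 5σ and `hσρ13`)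
    (B13₄ : ℝ) (θV13 Br13 BhD13 Bx13 Bd13 : ℝ → ℝ) (Bd2₁₃ : ℝ → ℝ → ℝ) (hθV13 : ∀ ε, 0 < ε → 0 ≤ θV13 ε) (hB13₄ : 0 ≤ B13₄) (hBr13 : ∀ ε, 0 < ε → 0 ≤ Br13 ε) (hBhD13 : ∀ β, 0 ≤ β → β < 1 → 0 ≤ BhD13 β) (hBx13 : ∀ β, 0 ≤ β → β < 1 → 0 ≤ Bx13 β)
    (hBd13 : ∀ ε, 0 < ε → ε ≤ 1 → 0 ≤ Bd13 ε) (hBd2₁₃ : ∀ ε β, 0 < ε → ε ≤ 1 → 0 ≤ β → β < 1 → 0 ≤ Bd2₁₃ ε β) (bHW13 : ∀ x : MemberY θ.d₆ θ.ℓ₆ θ.hd' θ.hL' θ.b₀ θ.b₁ Mstar, ℝ → BlockNorm (toB6 (geo9Y x) 1 (H12 x)) (W12 x → ℝ)) (hκW13 : ∀ x ε, (bHW13 x ε).κ ≤ κ13)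
    -- the CUT species (n06-l g19 `B9Thm313WholeLettersCut`): the G′ letter of (3.152) and the free class of G₁∇*_U, per member
    (Gp : ∀ x : MemberY θ.d₆ θ.ℓ₆ θ.hd' θ.hL' θ.b₀ θ.b₁ Mstar, (bg9Y (Matrix (Fin N) (Fin N) ℂ) (specialUnitaryUnits (Fin N)) x).Cfg → Module.End ℝ (W12 x → ℝ))
    (bXH : ∀ x : MemberY θ.d₆ θ.ℓ₆ θ.hd' θ.hL' θ.b₀ θ.b₁ Mstar, BlockNorm (toB6 (geo9Y x) 1 (H12 x)) (XBK (TrIdx N) x.toKIdx → ℝ)) (hκX : ∀ x, (bXH x).κ ≤ κ13)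
    (hmodel12 : ∀ x : MemberY θ.d₆ θ.ℓ₆ θ.hd' θ.hL' θ.b₀ θ.b₁ Mstar, M12 ≤ (geo9Y x).M → ∀ α₀ : ℝ, 0 < α₀ → (geo9Y x).M * α₀ ≤ a12 → ∀ U : (bg9Y (Matrix (Fin N) (Fin N) ℂ) (specialUnitaryUnits (Fin N)) x).Cfg, (bg9Y (Matrix (Fin N) (Fin N) ℂ) (specialUnitaryUnits (Fin N)) x).Reg335 c35Y α₀ U →
      (bg9Y (Matrix (Fin N) (Fin N) ℂ) (specialUnitaryUnits (Fin N)) x).Reg336 c35Y α₀ U → Thm33G0 (𝔬12 x) 1 (H12 x) B12₀ δ12₀ U ∧ B9Thm312Whole.Step (𝔬12 x) 1 (H12 x) (fun y => (geo9Y_len_pos x y).le) 1 (θ12 * ((geo9Y x).M * α₀)) δK12 U ∧ B9Thm312Whole.Step (𝔬12 x) 1 (H12 x) (fun y =>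
      (geo9Y_len_pos x y).le) 2 (θ12 * ((geo9Y x).M * α₀)) δK12 U ∧ FormSmall (𝔬12 x) (r12 * ((geo9Y x).M * α₀)) U ∧ B9Thm312Whole.Identities (𝔬12 x) U)
    (hleft12 : ∀ x : MemberY θ.d₆ θ.ℓ₆ θ.hd' θ.hL' θ.b₀ θ.b₁ Mstar, M12 ≤ (geo9Y x).M → ∀ α₀ : ℝ, 0 < α₀ → (geo9Y x).M * α₀ ≤ a12 → ∀ U : (bg9Y (Matrix (Fin N) (Fin N) ℂ) (specialUnitaryUnits (Fin N)) x).Cfg, (bg9Y (Matrix (Fin N) (Fin N) ℂ) (specialUnitaryUnits (Fin N)) x).Reg335 c35Y α₀ U → (bg9Y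
      (Matrix (Fin N) (Fin N) ℂ) (specialUnitaryUnits (Fin N)) x).Reg336 c35Y α₀ U → LeftStep (𝔬12 x) 1 (H12 x) (fun y => (geo9Y_len_pos x y).le) B12₀ δ12₀ (θD12 * ((geo9Y x).M * α₀)) δK12 U)
    (wZ : ∀ x : MemberY θ.d₆ θ.ℓ₆ θ.hd' θ.hL' θ.b₀ θ.b₁ Mstar, (geo9Y x).Site → ℝ) (hwZ : ∀ (x : MemberY θ.d₆ θ.ℓ₆ θ.hd' θ.hL' θ.b₀ θ.b₁ Mstar) (y : (geo9Y x).Site), 0 < wZ x y)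
    (hlettersH12 : ∀ x : MemberY θ.d₆ θ.ℓ₆ θ.hd' θ.hL' θ.b₀ θ.b₁ Mstar, M12 ≤ (geo9Y x).M → ∀ α₀ : ℝ, 0 < α₀ → (geo9Y x).M * α₀ ≤ a12 → ∀ U : (bg9Y (Matrix (Fin N) (Fin N) ℂ) (specialUnitaryUnits (Fin N)) x).Cfg, (bg9Y (Matrix (Fin N) (Fin N) ℂ) (specialUnitaryUnits (Fin N)) x).Reg335 c35Y α₀ U →
      (bg9Y (Matrix (Fin N) (Fin N) ℂ) (specialUnitaryUnits (Fin N)) x).Reg336 c35Y α₀ U → LettersHZ (𝔬12 x) 1 (H12 x) ⟨geo9Y_dist_triangle x, geo9Y_dist_comm x, geo9K_dist_nonneg x.toKIdx, geo9Y_len_pos x⟩ (weightNorm (BlockNorm.ofBlocks (toB6 (geo9Y x) 1 (H12 x)) (𝔬12 x).blkZ) (wZ x) (fun y => (hwZ x y).le)) B12₃ δ12₃ U)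
    (hpinE : ∀ x : MemberY θ.d₆ θ.ℓ₆ θ.hd' θ.hL' θ.b₀ θ.b₁ Mstar, ((opsYNuOfRecordV4PE N θ Mstar 𝔯 𝔢 𝔴 𝔈) x).HasRWExp = HasRWExpOfOps (𝔬12 x))
    (hpinH : ∀ x : MemberY θ.d₆ θ.ℓ₆ θ.hd' θ.hL' θ.b₀ θ.b₁ Mstar, ((opsYNuOfRecordV4PE N θ Mstar 𝔯 𝔢 𝔴 𝔈) x).HasRWExpH = HasRWExpHOfOps (𝔬12 x))
    (hpinK : ∀ x : MemberY θ.d₆ θ.ℓ₆ θ.hd' θ.hL' θ.b₀ θ.b₁ Mstar, ((opsYNuOfRecordV4PE N θ Mstar 𝔯 𝔢 𝔴 𝔈) x).PosDefK = PosDefKOfOps (𝔬12 x))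
    -- PINS of Theorems 3.12–3.13's walk letters to the coordinate models of the GENUINE `GD G₁ GG` — the nine `CoRealizesRel` and nine `CoReadsGlob` co-readings are theorems
    (hblk12 : ∀ x : MemberY θ.d₆ θ.ℓ₆ θ.hd' θ.hL' θ.b₀ θ.b₁ Mstar, (𝔬12 x).blk = blkBK x.toKIdx (bI x)) (hblkY12 : ∀ x : MemberY θ.d₆ θ.ℓ₆ θ.hd' θ.hL' θ.b₀ θ.b₁ Mstar, (𝔬12 x).blkY = blkBK x.toKIdx (bI x))
    (hGco12 : ∀ (x : MemberY θ.d₆ θ.ℓ₆ θ.hd' θ.hL' θ.b₀ θ.b₁ Mstar) (U : (bg9Y (Matrix (Fin N) (Fin N) ℂ) (specialUnitaryUnits (Fin N)) x).Cfg), (𝔬12 x).G U = GcoK x.toKIdx (trBasis N) (bg9Y (Matrix (Fin N) (Fin N) ℂ) (specialUnitaryUnits (Fin N)) x) (fun U => U) (lettersYOfRecordV4P N θ Mstar 𝔯 x).GD U)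
    (hG1co12 : ∀ (x : MemberY θ.d₆ θ.ℓ₆ θ.hd' θ.hL' θ.b₀ θ.b₁ Mstar) (U : (bg9Y (Matrix (Fin N) (Fin N) ℂ) (specialUnitaryUnits (Fin N)) x).Cfg), (𝔬12 x).G1 U = GcoK x.toKIdx (trBasis N) (bg9Y (Matrix (Fin N) (Fin N) ℂ) (specialUnitaryUnits (Fin N)) x) (fun U => U) (lettersYOfRecordV4P N θ Mstar 𝔯 x).G₁ U)
    (hGGco12 : ∀ (x : MemberY θ.d₆ θ.ℓ₆ θ.hd' θ.hL' θ.b₀ θ.b₁ Mstar) (U : (bg9Y (Matrix (Fin N) (Fin N) ℂ) (specialUnitaryUnits (Fin N)) x).Cfg), (𝔬12 x).GG U = GcoK x.toKIdx (trBasis N) (bg9Y (Matrix (Fin N) (Fin N) ℂ) (specialUnitaryUnits (Fin N)) x) (fun U => U) (lettersYOfRecordV4P N θ Mstar 𝔯 x).GG U)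
    (hDco12 : ∀ (x : MemberY θ.d₆ θ.ℓ₆ θ.hd' θ.hL' θ.b₀ θ.b₁ Mstar) (U : (bg9Y (Matrix (Fin N) (Fin N) ℂ) (specialUnitaryUnits (Fin N)) x).Cfg), (𝔬12 x).D U = DcoK x.toKIdx (trBasis N) (bg9Y (Matrix (Fin N) (Fin N) ℂ) (specialUnitaryUnits (Fin N)) x) (fun U => U) U)
    (hDsco12 : ∀ (x : MemberY θ.d₆ θ.ℓ₆ θ.hd' θ.hL' θ.b₀ θ.b₁ Mstar) (U : (bg9Y (Matrix (Fin N) (Fin N) ℂ) (specialUnitaryUnits (Fin N)) x).Cfg), (𝔬12 x).Dstar U = DscoK x.toKIdx (trBasis N) (bg9Y (Matrix (Fin N) (Fin N) ℂ) (specialUnitaryUnits (Fin N)) x) (fun U => U) U)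
    (hblkZ12 : ∀ x : MemberY θ.d₆ θ.ℓ₆ θ.hd' θ.hL' θ.b₀ θ.b₁ Mstar, (𝔬12 x).blkZ = blkHK x.toKIdx)
    (hHm12 : ∀ (x : MemberY θ.d₆ θ.ℓ₆ θ.hd' θ.hL' θ.b₀ θ.b₁ Mstar) (U : (bg9Y (Matrix (Fin N) (Fin N) ℂ) (specialUnitaryUnits (Fin N)) x).Cfg), (𝔬12 x).Hm U = HcoK x.toKIdx (trBasis N) (bg9Y (Matrix (Fin N) (Fin N) ℂ) (specialUnitaryUnits (Fin N)) x) (fun U => U) (lettersYOfRecordV4P N θ Mstar 𝔯 x).H U)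
    (hH1m12 : ∀ (x : MemberY θ.d₆ θ.ℓ₆ θ.hd' θ.hL' θ.b₀ θ.b₁ Mstar) (U : (bg9Y (Matrix (Fin N) (Fin N) ℂ) (specialUnitaryUnits (Fin N)) x).Cfg), (𝔬12 x).H1m U = HcoK x.toKIdx (trBasis N) (bg9Y (Matrix (Fin N) (Fin N) ℂ) (specialUnitaryUnits (Fin N)) x) (fun U => U) (lettersYOfRecordV4P N θ Mstar 𝔯 x).H₁ U)
    -- row 20's Hölder ∕ input ∕ H-Hölder co-readings on the PAIR family through the bond-carrier probes `𝔭A` (one probe family per carrier), and Theorem 3.3 ∕ the perturbation step ∕ the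
    -- H-letters in n06-l's direction-indexed schemas at the pinned single-direction letters `Dd ∕ Dds` (printed-shape hypothesis schemas; nothing of print asserted)
    (hH1N : ∀ (x : MemberY θ.d₆ θ.ℓ₆ θ.hd' θ.hL' θ.b₀ θ.b₁ Mstar) (U : (bg9Y (Matrix (Fin N) (Fin N) ℂ) (specialUnitaryUnits (Fin N)) x).Cfg), H1ReadsNbr ((opsYNuOfRecordV4PE N θ Mstar 𝔯 𝔢 𝔴 𝔈) x).GD U (𝔭A x) (RelB x.toKIdx) 2 (𝔬12 x).blk (𝔬12 x).blkY (evBK x.toKIdx) (evBK x.toKIdx) ((𝔬12 x).D U ∘ₗ (𝔬12 x).G U) ((𝔬12 x).G U ∘ₗ (𝔬12 x).Dstar U) ∧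
      H1ReadsNbr ((opsYNuOfRecordV4PE N θ Mstar 𝔯 𝔢 𝔴 𝔈) x).G₁ U (𝔭A x) (RelB x.toKIdx) 2 (𝔬12 x).blk (𝔬12 x).blkY (evBK x.toKIdx) (evBK x.toKIdx) ((𝔬12 x).D U ∘ₗ (𝔬12 x).G1 U) ((𝔬12 x).G1 U ∘ₗ (𝔬12 x).Dstar U) ∧
      H1ReadsNbr ((opsYNuOfRecordV4PE N θ Mstar 𝔯 𝔢 𝔴 𝔈) x).GG U (𝔭A x) (RelB x.toKIdx) 2 (𝔬12 x).blk (𝔬12 x).blkY (evBK x.toKIdx) (evBK x.toKIdx) ((𝔬12 x).D U ∘ₗ (𝔬12 x).GG U) ((𝔬12 x).GG U ∘ₗ (𝔬12 x).Dstar U))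
    (hIF : ∀ (x : MemberY θ.d₆ θ.ℓ₆ θ.hd' θ.hL' θ.b₀ θ.b₁ Mstar) (U : (bg9Y (Matrix (Fin N) (Fin N) ℂ) (specialUnitaryUnits (Fin N)) x).Cfg), InputReadsFam ((opsYNuOfRecordV4PE N θ Mstar 𝔯 𝔢 𝔴 𝔈) x).GD U (bHX12 x) 2 ((𝔬12 x).blk ∘ Prod.fst) ((𝔭A x).blkPX ∘ Prod.fst) (fun β => sliceProbe ((𝔭A x).ΦX U β)) (evBK x.toKIdx) (familyOp fun q : Fin (θ.d₆ + 1) × Fin (θ.d₆ + 1) => (Dd x) U q.1 ∘ₗ ((𝔬12 x).G U ∘ₗ (Dds x) U q.2)) ∧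
      InputReadsFam ((opsYNuOfRecordV4PE N θ Mstar 𝔯 𝔢 𝔴 𝔈) x).G₁ U (bHX12 x) 2 ((𝔬12 x).blk ∘ Prod.fst) ((𝔭A x).blkPX ∘ Prod.fst) (fun β => sliceProbe ((𝔭A x).ΦX U β)) (evBK x.toKIdx) (familyOp fun q : Fin (θ.d₆ + 1) × Fin (θ.d₆ + 1) => (Dd x) U q.1 ∘ₗ ((𝔬12 x).G1 U ∘ₗ (Dds x) U q.2)) ∧
      InputReadsFam ((opsYNuOfRecordV4PE N θ Mstar 𝔯 𝔢 𝔴 𝔈) x).GG U (bHX12 x) 2 ((𝔬12 x).blk ∘ Prod.fst) ((𝔭A x).blkPX ∘ Prod.fst) (fun β => sliceProbe ((𝔭A x).ΦX U β)) (evBK x.toKIdx) (familyOp fun q : Fin (θ.d₆ + 1) × Fin (θ.d₆ + 1) => (Dd x) U q.1 ∘ₗ ((𝔬12 x).GG U ∘ₗ (Dds x) U q.2)))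
    (hHCN : ∀ (x : MemberY θ.d₆ θ.ℓ₆ θ.hd' θ.hL' θ.b₀ θ.b₁ Mstar) (U : (bg9Y (Matrix (Fin N) (Fin N) ℂ) (specialUnitaryUnits (Fin N)) x).Cfg), CoReadsHHolderNbr ((opsYNuOfRecordV4PE N θ Mstar 𝔯 𝔢 𝔴 𝔈) x).H U (θ.d₆ + 1) (𝔭A x) 2 (𝔬12 x).blkZ ((𝔬12 x).D U ∘ₗ (𝔬12 x).Hm U) ∧ CoReadsHHolderNbr ((opsYNuOfRecordV4PE N θ Mstar 𝔯 𝔢 𝔴 𝔈) x).H₁ U (θ.d₆ + 1) (𝔭A x) 2 (𝔬12 x).blkZ ((𝔬12 x).D U ∘ₗ (𝔬12 x).H1m U))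
    (hsymD : ∀ (x : MemberY θ.d₆ θ.ℓ₆ θ.hd' θ.hL' θ.b₀ θ.b₁ Mstar) (U : (bg9Y (Matrix (Fin N) (Fin N) ℂ) (specialUnitaryUnits (Fin N)) x).Cfg), (∀ μ z, U μ z ∈ specialUnitaryUnits (Fin N)) → IsSymmTr (fun _ => (1 : ℝ)) ((lettersYOfRecordV4P N θ Mstar 𝔯 x).GD U) ∧ IsSymmTr (fun _ => (1 : ℝ)) ((lettersYOfRecordV4P N θ Mstar 𝔯 x).G₁ U) ∧ IsSymmTr (fun _ => (1 : ℝ)) ((lettersYOfRecordV4P N θ Mstar 𝔯 x).GG U))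
    (hG0C : ∀ x : MemberY θ.d₆ θ.ℓ₆ θ.hd' θ.hL' θ.b₀ θ.b₁ Mstar, M12 ≤ (geo9Y x).M → ∀ α₀ : ℝ, 0 < α₀ → (geo9Y x).M * α₀ ≤ a12 → ∀ U : (bg9Y (Matrix (Fin N) (Fin N) ℂ) (specialUnitaryUnits (Fin N)) x).Cfg, (bg9Y (Matrix (Fin N) (Fin N) ℂ) (specialUnitaryUnits (Fin N)) x).Reg335 c35Y α₀ U →
      (bg9Y (Matrix (Fin N) (Fin N) ℂ) (specialUnitaryUnits (Fin N)) x).Reg336 c35Y α₀ U →  Thm33G0Dir (𝔬12 x) (𝔭A x) (Dd x) (Dds x) 1 (H12 x) (bHX12 x) B12₀ Bh12 Bi12 Bi2₁₂ δ12₀ U ∧ Thm33G0DirR (𝔬12 x) (Dds x) 1 (H12 x) B12₀ δ12₀ U ∧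
      Thm33G0L2M (𝔬12 x) (Dd x) (Dds x) 1 (H12 x) B12₂ δ12₀ U)
    (hstepC : ∀ x : MemberY θ.d₆ θ.ℓ₆ θ.hd' θ.hL' θ.b₀ θ.b₁ Mstar, M12 ≤ (geo9Y x).M → ∀ α₀ : ℝ, 0 < α₀ → (geo9Y x).M * α₀ ≤ a12 → ∀ U : (bg9Y (Matrix (Fin N) (Fin N) ℂ) (specialUnitaryUnits (Fin N)) x).Cfg, (bg9Y (Matrix (Fin N) (Fin N) ℂ) (specialUnitaryUnits (Fin N)) x).Reg335 c35Y α₀ U →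
      (bg9Y (Matrix (Fin N) (Fin N) ℂ) (specialUnitaryUnits (Fin N)) x).Reg336 c35Y α₀ U →  StepDirB (𝔬12 x) (𝔭A x) (Dd x) (Dds x) 1 (H12 x) (bHX12 x) (fun y => (geo9Y_len_pos x y).le) (θD12 * ((geo9Y x).M * α₀)) (fun β => θH12 β * ((geo9Y x).M * α₀)) (fun ε => θI12 ε * ((geo9Y x).M * α₀)) δK12 U ∧
      StepL2 (𝔬12 x) 1 (H12 x) (θ2₁₂ * ((geo9Y x).M * α₀)) δK12 U)
    (hLHH : ∀ x : MemberY θ.d₆ θ.ℓ₆ θ.hd' θ.hL' θ.b₀ θ.b₁ Mstar, M12 ≤ (geo9Y x).M → ∀ α₀ : ℝ, 0 < α₀ → (geo9Y x).M * α₀ ≤ a12 → ∀ U : (bg9Y (Matrix (Fin N) (Fin N) ℂ) (specialUnitaryUnits (Fin N)) x).Cfg, (bg9Y (Matrix (Fin N) (Fin N) ℂ) (specialUnitaryUnits (Fin N)) x).Reg335 c35Y α₀ U →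
      (bg9Y (Matrix (Fin N) (Fin N) ℂ) (specialUnitaryUnits (Fin N)) x).Reg336 c35Y α₀ U →  LettersHHZ (𝔬12 x) (𝔭A x) 1 (H12 x) (fun y => (geo9Y_len_pos x y).le) (weightNorm (BlockNorm.ofBlocks (toB6 (geo9Y x) 1 (H12 x)) (𝔬12 x).blkZ) (wZ x) (fun y => (hwZ x y).le)) Bq12 δ12₃ U)
    (hLH3 : ∀ x : MemberY θ.d₆ θ.ℓ₆ θ.hd' θ.hL' θ.b₀ θ.b₁ Mstar, M12 ≤ (geo9Y x).M → ∀ α₀ : ℝ, 0 < α₀ → (geo9Y x).M * α₀ ≤ a12 → ∀ U : (bg9Y (Matrix (Fin N) (Fin N) ℂ) (specialUnitaryUnits (Fin N)) x).Cfg, (bg9Y (Matrix (Fin N) (Fin N) ℂ) (specialUnitaryUnits (Fin N)) x).Reg335 c35Y α₀ U →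
      (bg9Y (Matrix (Fin N) (Fin N) ℂ) (specialUnitaryUnits (Fin N)) x).Reg336 c35Y α₀ U → Letters313HZc (𝔬12 x) (𝔭A x) (Gp x) 1 (H12 x) ⟨geo9Y_dist_triangle x, geo9Y_dist_comm x, geo9K_dist_nonneg x.toKIdx, geo9Y_len_pos x⟩ (wZ x) (hwZ x) (bH13 x) BhD13 Bx13 δ12₃ (bXH x) U)
    (vZ : ∀ x : MemberY θ.d₆ θ.ℓ₆ θ.hd' θ.hL' θ.b₀ θ.b₁ Mstar, (geo9Y x).Site → ℝ) (hvZ : ∀ (x : MemberY θ.d₆ θ.ℓ₆ θ.hd' θ.hL' θ.b₀ θ.b₁ Mstar) (y : (geo9Y x).Site), 0 < vZ x y)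
    (hLL2 : ∀ x : MemberY θ.d₆ θ.ℓ₆ θ.hd' θ.hL' θ.b₀ θ.b₁ Mstar, M12 ≤ (geo9Y x).M → ∀ α₀ : ℝ, 0 < α₀ → (geo9Y x).M * α₀ ≤ a12 → ∀ U : (bg9Y (Matrix (Fin N) (Fin N) ℂ) (specialUnitaryUnits (Fin N)) x).Cfg, (bg9Y (Matrix (Fin N) (Fin N) ℂ) (specialUnitaryUnits (Fin N)) x).Reg335 c35Y α₀ U →
      (bg9Y (Matrix (Fin N) (Fin N) ℂ) (specialUnitaryUnits (Fin N)) x).Reg336 c35Y α₀ U → Letters313L2Pc (𝔬12 x) (Dd x) (Dds x) 1 (H12 x) B13₄ δ12₃ (vZ x) (hvZ x) U ∧ Letters313L2MZ (𝔬12 x) (Dd x) (Dds x) 1 (H12 x) B13₄ δ12₃ (vZ x) (hvZ x) U)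
    (hLIM : ∀ x : MemberY θ.d₆ θ.ℓ₆ θ.hd' θ.hL' θ.b₀ θ.b₁ Mstar, M12 ≤ (geo9Y x).M → ∀ α₀ : ℝ, 0 < α₀ → (geo9Y x).M * α₀ ≤ a12 → ∀ U : (bg9Y (Matrix (Fin N) (Fin N) ℂ) (specialUnitaryUnits (Fin N)) x).Cfg, (bg9Y (Matrix (Fin N) (Fin N) ℂ) (specialUnitaryUnits (Fin N)) x).Reg335 c35Y α₀ U →
      (bg9Y (Matrix (Fin N) (Fin N) ℂ) (specialUnitaryUnits (Fin N)) x).Reg336 c35Y α₀ U → Letters313IMBC (𝔬12 x) (𝔭A x) (Dd x) (Dds x) 1 (H12 x) (fun y => (geo9Y_len_pos x y).le) (bHX12 x) (bHW13 x) Br13 (fun ε => θV13 ε * ((geo9Y x).M * α₀)) Bd13 Bd2₁₃ δ12₃ δK12 (RelB x.toKIdx) U)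
    (hletters13 : ∀ x : MemberY θ.d₆ θ.ℓ₆ θ.hd' θ.hL' θ.b₀ θ.b₁ Mstar, M12 ≤ (geo9Y x).M → ∀ α₀ : ℝ, 0 < α₀ → (geo9Y x).M * α₀ ≤ a12 → ∀ U : (bg9Y (Matrix (Fin N) (Fin N) ℂ) (specialUnitaryUnits (Fin N)) x).Cfg, (bg9Y (Matrix (Fin N) (Fin N) ℂ) (specialUnitaryUnits (Fin N)) x).Reg335 c35Y α₀ U →
      (bg9Y (Matrix (Fin N) (Fin N) ℂ) (specialUnitaryUnits (Fin N)) x).Reg336 c35Y α₀ U → Letters313Zc (𝔬12 x) (Gp x) 1 (H12 x) ⟨geo9Y_dist_triangle x, geo9Y_dist_comm x, geo9K_dist_nonneg x.toKIdx, geo9Y_len_pos x⟩ (wZ x) (hwZ x) B12₃ δ12₃ (bXH x) U)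
    (h152 : ∀ x : MemberY θ.d₆ θ.ℓ₆ θ.hd' θ.hL' θ.b₀ θ.b₁ Mstar, M12 ≤ (geo9Y x).M → ∀ α₀ : ℝ, 0 < α₀ → (geo9Y x).M * α₀ ≤ a12 → ∀ U : (bg9Y (Matrix (Fin N) (Fin N) ℂ) (specialUnitaryUnits (Fin N)) x).Cfg, (bg9Y (Matrix (Fin N) (Fin N) ℂ) (specialUnitaryUnits (Fin N)) x).Reg335 c35Y α₀ U →
      (bg9Y (Matrix (Fin N) (Fin N) ℂ) (specialUnitaryUnits (Fin N)) x).Reg336 c35Y α₀ U → Ids3152 (𝔬12 x) (Gp x) U)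
    (hlettersD13 : ∀ x : MemberY θ.d₆ θ.ℓ₆ θ.hd' θ.hL' θ.b₀ θ.b₁ Mstar, M12 ≤ (geo9Y x).M → ∀ α₀ : ℝ, 0 < α₀ → (geo9Y x).M * α₀ ≤ a12 → ∀ U : (bg9Y (Matrix (Fin N) (Fin N) ℂ) (specialUnitaryUnits (Fin N)) x).Cfg, (bg9Y (Matrix (Fin N) (Fin N) ℂ) (specialUnitaryUnits (Fin N)) x).Reg335 c35Y α₀ U →
      (bg9Y (Matrix (Fin N) (Fin N) ℂ) (specialUnitaryUnits (Fin N)) x).Reg336 c35Y α₀ U → Letters313DZ (𝔬12 x) 1 (H12 x) ⟨geo9Y_dist_triangle x, geo9Y_dist_comm x, geo9K_dist_nonneg x.toKIdx, geo9Y_len_pos x⟩ (wZ x) (hwZ x) B12₃ δ12₃ (bH13 x) U ∧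
        Letters313DMZ (𝔬12 x) (𝔭A x) (Dd x) 1 (H12 x) ⟨geo9Y_dist_triangle x, geo9Y_dist_comm x, geo9K_dist_nonneg x.toKIdx, geo9Y_len_pos x⟩ (wZ x) (hwZ x) B12₃ Bq12 δ12₃ (bH13 x) U)
    : B9.Thm312Printed (θ.d₆ + 1) c35Y geo9Y (bg9Y (Matrix (Fin N) (Fin N) ℂ) (specialUnitaryUnits (Fin N))) (fun x => ((opsYNuOfRecordV4PE N θ Mstar 𝔯 𝔢 𝔴 𝔈) x).GD) (fun x => ((opsYNuOfRecordV4PE N θ Mstar 𝔯 𝔢 𝔴 𝔈) x).G₁) (fun x => ((opsYNuOfRecordV4PE N θ Mstar 𝔯 𝔢 𝔴 𝔈) x).H) (fun x => ((opsYNuOfRecordV4PE N θ Mstar 𝔯 𝔢 𝔴 𝔈) x).H₁)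
        (fun x => ((opsYNuOfRecordV4PE N θ Mstar 𝔯 𝔢 𝔴 𝔈) x).HasRWExp) (fun x => ((opsYNuOfRecordV4PE N θ Mstar 𝔯 𝔢 𝔴 𝔈) x).HasRWExpH) (fun x => ((opsYNuOfRecordV4PE N θ Mstar 𝔯 𝔢 𝔴 𝔈) x).PosDefK) ∧
      B9.Thm313Printed c35Y geo9Y (bg9Y (Matrix (Fin N) (Fin N) ℂ) (specialUnitaryUnits (Fin N))) (fun x => ((opsYNuOfRecordV4PE N θ Mstar 𝔯 𝔢 𝔴 𝔈) x).GG) (fun x => ((opsYNuOfRecordV4PE N θ Mstar 𝔯 𝔢 𝔴 𝔈) x).HasRWExp) (fun x => ((opsYNuOfRecordV4PE N θ Mstar 𝔯 𝔢 𝔴 𝔈) x).PosDefK) := by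
  have hL1 : (1 : ℝ) ≤ ((θ.ℓ₆ + 1 : ℕ) : ℝ) := by exact_mod_cast Nat.succ_le_succ (Nat.zero_le _)
  have hsat : ∀ (x : MemberY θ.d₆ θ.ℓ₆ θ.hd' θ.hL' θ.b₀ θ.b₁ Mstar) (n : Fin 4) (B' δ' : ℝ),
      (∀ a a' b, RelB x.toKIdx a a' → maj342 (geo9Y x) n B' δ' a b = maj342 (geo9Y x) n B' δ' a' b) ∧
      (∀ a b b', RelB x.toKIdx b b' → maj342 (geo9Y x) n B' δ' a b = maj342 (geo9Y x) n B' δ' a b') :=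
    fun x n B' δ' => ⟨fun a a' b h => maj342_relB_left x.toKIdx n B' δ' a a' b h, fun a b b' h => maj342_relB_right x.toKIdx n B' δ' a b b' h⟩
  have hmult : ∀ (x : MemberY θ.d₆ θ.ℓ₆ θ.hd' θ.hL' θ.b₀ θ.b₁ Mstar) (y' : (geo9Y x).Site),
      (Finset.univ.filter (fun y'' : (geo9Y x).Site => RelB x.toKIdx y'' y')).card ≤ 2 * (θ.d₆ + 1) := fun x y' => by
    refine le_trans (Finset.card_le_card fun c hc => ?_) (card_sameCarrier_le_kIdx x.toKIdx y')
    exact Finset.mem_filter.2 ⟨@Finset.mem_univ _ (_) c, (Finset.mem_filter.1 hc).2⟩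
  have hRdist : ∀ (x : MemberY θ.d₆ θ.ℓ₆ θ.hd' θ.hL' θ.b₀ θ.b₁ Mstar) (a a' b : (geo9Y x).Site), RelB x.toKIdx a a' → (geo9Y x).dist a b = (geo9Y x).dist a' b :=
    fun x a a' b h => dist_eq_of_relB x.toKIdx h (relB_refl x.toKIdx b)
  have hRlen : ∀ (x : MemberY θ.d₆ θ.ℓ₆ θ.hd' θ.hL' θ.b₀ θ.b₁ Mstar) (a a' : (geo9Y x).Site), RelB x.toKIdx a a' → (geo9Y x).len a = (geo9Y x).len a' :=
    fun x a a' h => len_eq_of_relB x.toKIdx h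
  -- the (3.42)∕(3.47)∕(3.133) co-readings of G_D, G₁, 𝔊, H, H₁ at the pins (`N06CoReadingsOfPins`, `B9CoReadingCoordsH`)
  letI hF : ∀ x : MemberY θ.d₆ θ.ℓ₆ θ.hd' θ.hL' θ.b₀ θ.b₁ Mstar, Fintype (B9GeoNormsKLevelV1.geo9K x.toKIdx).Site := fun x => (inferInstance : Fintype (geo9Y x).Site)
  have hGD := fun (x : MemberY θ.d₆ θ.ℓ₆ θ.hd' θ.hL' θ.b₀ θ.b₁ Mstar) (U : (bg9Y (Matrix (Fin N) (Fin N) ℂ) (specialUnitaryUnits (Fin N)) x).Cfg) => bond_coReadings3_of_pins x.toKIdx (trBasis N) (bg9Y (Matrix (Fin N) (Fin N) ℂ) (specialUnitaryUnits (Fin N)) x) (fun U => U) (lettersYOfRecordV4P N θ Mstar 𝔯 x).GD (lettersYOfRecordV4P N θ Mstar 𝔯 x).parB U (hβI x) (hlev x) (hblk12 x) (hblkY12 x) (hGco12 x U) (hDco12 x U) (hDsco12 x U)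
  have hG1 := fun (x : MemberY θ.d₆ θ.ℓ₆ θ.hd' θ.hL' θ.b₀ θ.b₁ Mstar) (U : (bg9Y (Matrix (Fin N) (Fin N) ℂ) (specialUnitaryUnits (Fin N)) x).Cfg) => bond_coReadings3_of_pins x.toKIdx (trBasis N) (bg9Y (Matrix (Fin N) (Fin N) ℂ) (specialUnitaryUnits (Fin N)) x) (fun U => U) (lettersYOfRecordV4P N θ Mstar 𝔯 x).G₁ (lettersYOfRecordV4P N θ Mstar 𝔯 x).parB U (hβI x) (hlev x) (hblk12 x) (hblkY12 x) (hG1co12 x U) (hDco12 x U) (hDsco12 x U)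
  have hGG := fun (x : MemberY θ.d₆ θ.ℓ₆ θ.hd' θ.hL' θ.b₀ θ.b₁ Mstar) (U : (bg9Y (Matrix (Fin N) (Fin N) ℂ) (specialUnitaryUnits (Fin N)) x).Cfg) => bond_coReadings3_of_pins x.toKIdx (trBasis N) (bg9Y (Matrix (Fin N) (Fin N) ℂ) (specialUnitaryUnits (Fin N)) x) (fun U => U) (lettersYOfRecordV4P N θ Mstar 𝔯 x).GG (lettersYOfRecordV4P N θ Mstar 𝔯 x).parB U (hβI x) (hlev x) (hblk12 x) (hblkY12 x) (hGGco12 x U) (hDco12 x U) (hDsco12 x U)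
  have hHH := fun (x : MemberY θ.d₆ θ.ℓ₆ θ.hd' θ.hL' θ.b₀ θ.b₁ Mstar) (U : (bg9Y (Matrix (Fin N) (Fin N) ℂ) (specialUnitaryUnits (Fin N)) x).Cfg) => coRealizesHRel_of_pins x.toKIdx (trBasis N) (bg9Y (Matrix (Fin N) (Fin N) ℂ) (specialUnitaryUnits (Fin N)) x) (fun U => U) (lettersYOfRecordV4P N θ Mstar 𝔯 x).H (lettersYOfRecordV4P N θ Mstar 𝔯 x).parB U (hβI x) (hblk12 x) (hblkY12 x) (hblkZ12 x) (hHm12 x U) (hDco12 x U)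
  have hHH1 := fun (x : MemberY θ.d₆ θ.ℓ₆ θ.hd' θ.hL' θ.b₀ θ.b₁ Mstar) (U : (bg9Y (Matrix (Fin N) (Fin N) ℂ) (specialUnitaryUnits (Fin N)) x).Cfg) => coRealizesHRel_of_pins x.toKIdx (trBasis N) (bg9Y (Matrix (Fin N) (Fin N) ℂ) (specialUnitaryUnits (Fin N)) x) (fun U => U) (lettersYOfRecordV4P N θ Mstar 𝔯 x).H₁ (lettersYOfRecordV4P N θ Mstar 𝔯 x).parB U (hβI x) (hblk12 x) (hblkY12 x) (hblkZ12 x) (hH1m12 x U) (hDco12 x U)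
  have hcoHR12 := fun (x : MemberY θ.d₆ θ.ℓ₆ θ.hd' θ.hL' θ.b₀ θ.b₁ Mstar) (U : (bg9Y (Matrix (Fin N) (Fin N) ℂ) (specialUnitaryUnits (Fin N)) x).Cfg) => And.intro (hHH x U).1 (And.intro (hHH x U).2 (And.intro (hHH1 x U).1 (hHH1 x U).2))
  have hcoR12 := fun (x : MemberY θ.d₆ θ.ℓ₆ θ.hd' θ.hL' θ.b₀ θ.b₁ Mstar) (U : (bg9Y (Matrix (Fin N) (Fin N) ℂ) (specialUnitaryUnits (Fin N)) x).Cfg) => And.intro (hGD x U).1 (And.intro (hGD x U).2.2.1 (And.intro (hG1 x U).1 (hG1 x U).2.2.1))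
  have hco1R12 := fun (x : MemberY θ.d₆ θ.ℓ₆ θ.hd' θ.hL' θ.b₀ θ.b₁ Mstar) (U : (bg9Y (Matrix (Fin N) (Fin N) ℂ) (specialUnitaryUnits (Fin N)) x).Cfg) => And.intro (hGD x U).2.1 (hG1 x U).2.1
  have hcoG12 := fun (x : MemberY θ.d₆ θ.ℓ₆ θ.hd' θ.hL' θ.b₀ θ.b₁ Mstar) (U : (bg9Y (Matrix (Fin N) (Fin N) ℂ) (specialUnitaryUnits (Fin N)) x).Cfg) => And.intro (hGD x U).2.2.2.1 (And.intro (hGD x U).2.2.2.2.1 (And.intro (hGD x U).2.2.2.2.2.1 (And.intro (hG1 x U).2.2.2.1 (And.intro (hG1 x U).2.2.2.2.1 (hG1 x U).2.2.2.2.2.1))))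
  -- row 20's twelve (3.46) L² readings of G_D, G₁ are THEOREMS on the coordinate models (`bond_l2ReadsNbr3_of_pins` + n06-k `bond_l2ReadsNbr345_of_pins` at the pinned direction letters)
  have hDL := fun (x : MemberY θ.d₆ θ.ℓ₆ θ.hd' θ.hL' θ.b₀ θ.b₁ Mstar) (U : (bg9Y (Matrix (Fin N) (Fin N) ℂ) (specialUnitaryUnits (Fin N)) x).Cfg) => bond_l2ReadsNbr3_of_pins x.toKIdx (trBasis N) (bg9Y (Matrix (Fin N) (Fin N) ℂ) (specialUnitaryUnits (Fin N)) x) (fun U => U) (lettersYOfRecordV4P N θ Mstar 𝔯 x).GD (lettersYOfRecordV4P N θ Mstar 𝔯 x).parB U (R := (1 : ℝ)) (H := H12 x) (hβI x) (hβ1 x) (hblk12 x) (hblkY12 x) (hGco12 x U) (hDco12 x U) (hDsco12 x U)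
  have hDL3 := fun (x : MemberY θ.d₆ θ.ℓ₆ θ.hd' θ.hL' θ.b₀ θ.b₁ Mstar) (U : (bg9Y (Matrix (Fin N) (Fin N) ℂ) (specialUnitaryUnits (Fin N)) x).Cfg) => bond_l2ReadsNbr345_of_pins x.toKIdx (trBasis N) (bg9Y (Matrix (Fin N) (Fin N) ℂ) (specialUnitaryUnits (Fin N)) x) (fun U => U) (lettersYOfRecordV4P N θ Mstar 𝔯 x).GD (lettersYOfRecordV4P N θ Mstar 𝔯 x).parB U (R := (1 : ℝ)) (H := H12 x) (hβI x) (hβ1 x) (hblk12 x) (hGco12 x U) (hDd x U) (hDds x U)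
  have h1L := fun (x : MemberY θ.d₆ θ.ℓ₆ θ.hd' θ.hL' θ.b₀ θ.b₁ Mstar) (U : (bg9Y (Matrix (Fin N) (Fin N) ℂ) (specialUnitaryUnits (Fin N)) x).Cfg) => bond_l2ReadsNbr3_of_pins x.toKIdx (trBasis N) (bg9Y (Matrix (Fin N) (Fin N) ℂ) (specialUnitaryUnits (Fin N)) x) (fun U => U) (lettersYOfRecordV4P N θ Mstar 𝔯 x).G₁ (lettersYOfRecordV4P N θ Mstar 𝔯 x).parB U (R := (1 : ℝ)) (H := H12 x) (hβI x) (hβ1 x) (hblk12 x) (hblkY12 x) (hG1co12 x U) (hDco12 x U) (hDsco12 x U)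
  have h1L3 := fun (x : MemberY θ.d₆ θ.ℓ₆ θ.hd' θ.hL' θ.b₀ θ.b₁ Mstar) (U : (bg9Y (Matrix (Fin N) (Fin N) ℂ) (specialUnitaryUnits (Fin N)) x).Cfg) => bond_l2ReadsNbr345_of_pins x.toKIdx (trBasis N) (bg9Y (Matrix (Fin N) (Fin N) ℂ) (specialUnitaryUnits (Fin N)) x) (fun U => U) (lettersYOfRecordV4P N θ Mstar 𝔯 x).G₁ (lettersYOfRecordV4P N θ Mstar 𝔯 x).parB U (R := (1 : ℝ)) (H := H12 x) (hβI x) (hβ1 x) (hblk12 x) (hG1co12 x U) (hDd x U) (hDds x U)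
  have hGL := fun (x : MemberY θ.d₆ θ.ℓ₆ θ.hd' θ.hL' θ.b₀ θ.b₁ Mstar) (U : (bg9Y (Matrix (Fin N) (Fin N) ℂ) (specialUnitaryUnits (Fin N)) x).Cfg) => bond_l2ReadsNbr3_of_pins x.toKIdx (trBasis N) (bg9Y (Matrix (Fin N) (Fin N) ℂ) (specialUnitaryUnits (Fin N)) x) (fun U => U) (lettersYOfRecordV4P N θ Mstar 𝔯 x).GG (lettersYOfRecordV4P N θ Mstar 𝔯 x).parB U (R := (1 : ℝ)) (H := H12 x) (hβI x) (hβ1 x) (hblk12 x) (hblkY12 x) (hGGco12 x U) (hDco12 x U) (hDsco12 x U)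
  have hGL3 := fun (x : MemberY θ.d₆ θ.ℓ₆ θ.hd' θ.hL' θ.b₀ θ.b₁ Mstar) (U : (bg9Y (Matrix (Fin N) (Fin N) ℂ) (specialUnitaryUnits (Fin N)) x).Cfg) => bond_l2ReadsNbr345_of_pins x.toKIdx (trBasis N) (bg9Y (Matrix (Fin N) (Fin N) ℂ) (specialUnitaryUnits (Fin N)) x) (fun U => U) (lettersYOfRecordV4P N θ Mstar 𝔯 x).GG (lettersYOfRecordV4P N θ Mstar 𝔯 x).parB U (R := (1 : ℝ)) (H := H12 x) (hβI x) (hβ1 x) (hblk12 x) (hGGco12 x U) (hDd x U) (hDds x U)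
  have hsym12 : ∀ x : MemberY θ.d₆ θ.ℓ₆ θ.hd' θ.hL' θ.b₀ θ.b₁ Mstar, M12 ≤ (geo9Y x).M → ∀ α₀ : ℝ, 0 < α₀ → (geo9Y x).M * α₀ ≤ a12 → ∀ U : (bg9Y (Matrix (Fin N) (Fin N) ℂ) (specialUnitaryUnits (Fin N)) x).Cfg, (bg9Y (Matrix (Fin N) (Fin N) ℂ) (specialUnitaryUnits (Fin N)) x).Reg335 c35Y α₀ U →
      (bg9Y (Matrix (Fin N) (Fin N) ℂ) (specialUnitaryUnits (Fin N)) x).Reg336 c35Y α₀ U → 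
        (IsTransposePair ((𝔬12 x).G U) ((𝔬12 x).G U) ∧ IsTransposePair ((𝔬12 x).G1 U) ((𝔬12 x).G1 U)) ∧
        (IsTransposePair ((𝔬12 x).D U ∘ₗ (𝔬12 x).G U) ((𝔬12 x).G U ∘ₗ (𝔬12 x).Dstar U) ∧ IsTransposePair ((𝔬12 x).D U ∘ₗ (𝔬12 x).G1 U) ((𝔬12 x).G1 U ∘ₗ (𝔬12 x).Dstar U)) :=
    fun x _ α₀ _ _ U hU _ => by
    obtain ⟨hD, h1, -⟩ := hsymD x U hU.1.1
    rw [hGco12 x U, hG1co12 x U, hDco12 x U, hDsco12 x U]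
    exact ⟨⟨isTransposePair_GcoK_trBasis x.toKIdx (bg9Y (Matrix (Fin N) (Fin N) ℂ) (specialUnitaryUnits (Fin N)) x) (fun U => U) (lettersYOfRecordV4P N θ Mstar 𝔯 x).GD U hD, isTransposePair_GcoK_trBasis x.toKIdx (bg9Y (Matrix (Fin N) (Fin N) ℂ) (specialUnitaryUnits (Fin N)) x) (fun U => U) (lettersYOfRecordV4P N θ Mstar 𝔯 x).G₁ U h1⟩,
      ⟨isTransposePair_DcoK_GcoK_trBasis x.toKIdx (bg9Y (Matrix (Fin N) (Fin N) ℂ) (specialUnitaryUnits (Fin N)) x) (fun U => U) (lettersYOfRecordV4P N θ Mstar 𝔯 x).GD U hD (fun μ z => specialUnitaryUnits_le_unitaryUnits (hU.1.1 μ z)),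
        isTransposePair_DcoK_GcoK_trBasis x.toKIdx (bg9Y (Matrix (Fin N) (Fin N) ℂ) (specialUnitaryUnits (Fin N)) x) (fun U => U) (lettersYOfRecordV4P N θ Mstar 𝔯 x).G₁ U h1 (fun μ z => specialUnitaryUnits_le_unitaryUnits (hU.1.1 μ z))⟩⟩
  have hsym13 : ∀ x : MemberY θ.d₆ θ.ℓ₆ θ.hd' θ.hL' θ.b₀ θ.b₁ Mstar, M12 ≤ (geo9Y x).M → ∀ α₀ : ℝ, 0 < α₀ → (geo9Y x).M * α₀ ≤ a12 → ∀ U : (bg9Y (Matrix (Fin N) (Fin N) ℂ) (specialUnitaryUnits (Fin N)) x).Cfg, (bg9Y (Matrix (Fin N) (Fin N) ℂ) (specialUnitaryUnits (Fin N)) x).Reg335 c35Y α₀ U →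
      (bg9Y (Matrix (Fin N) (Fin N) ℂ) (specialUnitaryUnits (Fin N)) x).Reg336 c35Y α₀ U → IsTransposePair ((𝔬12 x).GG U) ((𝔬12 x).GG U) ∧ IsTransposePair ((𝔬12 x).D U ∘ₗ (𝔬12 x).GG U) ((𝔬12 x).GG U ∘ₗ (𝔬12 x).Dstar U) :=
    fun x _ α₀ _ _ U hU _ => by
    obtain ⟨-, -, hG⟩ := hsymD x U hU.1.1
    rw [hGGco12 x U, hDco12 x U, hDsco12 x U]
    exact ⟨isTransposePair_GcoK_trBasis x.toKIdx (bg9Y (Matrix (Fin N) (Fin N) ℂ) (specialUnitaryUnits (Fin N)) x) (fun U => U) (lettersYOfRecordV4P N θ Mstar 𝔯 x).GG U hG,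
      isTransposePair_DcoK_GcoK_trBasis x.toKIdx (bg9Y (Matrix (Fin N) (Fin N) ℂ) (specialUnitaryUnits (Fin N)) x) (fun U => U) (lettersYOfRecordV4P N θ Mstar 𝔯 x).GG U hG (fun μ z => specialUnitaryUnits_le_unitaryUnits (hU.1.1 μ z))⟩
  have hcoR13 := fun (x : MemberY θ.d₆ θ.ℓ₆ θ.hd' θ.hL' θ.b₀ θ.b₁ Mstar) (U : (bg9Y (Matrix (Fin N) (Fin N) ℂ) (specialUnitaryUnits (Fin N)) x).Cfg) => And.intro (hGG x U).1 (hGG x U).2.2.1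
  have hco1R13 := fun (x : MemberY θ.d₆ θ.ℓ₆ θ.hd' θ.hL' θ.b₀ θ.b₁ Mstar) (U : (bg9Y (Matrix (Fin N) (Fin N) ℂ) (specialUnitaryUnits (Fin N)) x).Cfg) => (hGG x U).2.1
  have hcoG13 := fun (x : MemberY θ.d₆ θ.ℓ₆ θ.hd' θ.hL' θ.b₀ θ.b₁ Mstar) (U : (bg9Y (Matrix (Fin N) (Fin N) ℂ) (specialUnitaryUnits (Fin N)) x).Cfg) => And.intro (hGG x U).2.2.2.1 (And.intro (hGG x U).2.2.2.2.1 (hGG x U).2.2.2.2.2.1)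
  have hgeoOK : ∀ x : MemberY θ.d₆ θ.ℓ₆ θ.hd' θ.hL' θ.b₀ θ.b₁ Mstar, GeoOK (geo9Y x) := fun x => ⟨geo9Y_dist_triangle x, geo9Y_dist_comm x, geo9K_dist_nonneg x.toKIdx, geo9Y_len_pos x⟩
  obtain ⟨ML12, c12, hrow12⟩ := rowSum261_geo9Y (d := θ.d₆) (ℓ := θ.ℓ₆) (hd := θ.hd') (hL := θ.hL') (b₀ := θ.b₀) (b₁ := θ.b₁) (Mstar := Mstar) σ12 hσ12
  have hrow : ∀ x : MemberY θ.d₆ θ.ℓ₆ θ.hd' θ.hL' θ.b₀ θ.b₁ Mstar, ML12 ≤ (geo9Y x).M → RowSum (toB6 (geo9Y x) 1 (H12 x)) σ12 (max c12 0) := fun x hM y => (hrow12 x hM y).trans (le_max_left _ _)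
  have hE : (fun x => ((opsYNuOfRecordV4PE N θ Mstar 𝔯 𝔢 𝔴 𝔈) x).HasRWExp) = fun x => HasRWExpOfOps (𝔬12 x) := funext hpinE
  have hH : (fun x => ((opsYNuOfRecordV4PE N θ Mstar 𝔯 𝔢 𝔴 𝔈) x).HasRWExpH) = fun x => HasRWExpHOfOps (𝔬12 x) := funext hpinH
  have hK' : (fun x => ((opsYNuOfRecordV4PE N θ Mstar 𝔯 𝔢 𝔴 𝔈) x).PosDefK) = fun x => PosDefKOfOps (𝔬12 x) := funext hpinK
  have hη : ∀ x : MemberY θ.d₆ θ.ℓ₆ θ.hd' θ.hL' θ.b₀ θ.b₁ Mstar, 0 < (geo9Y x).eta := fun x => (distOK_geo9Y x).eta_pos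
  have hL21 := lemma21AboveG_geo9Y (d := θ.d₆) (ℓ := θ.ℓ₆) (hd := θ.hd') (hL := θ.hL') (b₀ := θ.b₀) (b₁ := θ.b₁) (Mstar := Mstar) H12 hα12 (hα12'.trans_lt one_half_lt_one)
  refine ⟨?_, ?_⟩
  · rw [hE, hH, hK']
    exact thm312Printed_completePairMBZ 𝔬12 (fun _ => 1) H12 𝔭A bHX12 (fun x => (Dd x)) (fun x => (Dds x)) (fun x => ((opsYNuOfRecordV4PE N θ Mstar 𝔯 𝔢 𝔴 𝔈) x).GD) (fun x => ((opsYNuOfRecordV4PE N θ Mstar 𝔯 𝔢 𝔴 𝔈) x).G₁)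
      (fun x => ((opsYNuOfRecordV4PE N θ Mstar 𝔯 𝔢 𝔴 𝔈) x).H) (fun x => ((opsYNuOfRecordV4PE N θ Mstar 𝔯 𝔢 𝔴 𝔈) x).H₁) (fun x => evBK x.toKIdx) (fun x => evBK x.toKIdx) (fun x => RelB x.toKIdx) (2 * (θ.d₆ + 1)) (nbrCountY θ.d₆ θ.ℓ₆ θ.hd' θ.hL' θ.b₀ θ.b₁ 2)
      2 (Real.sqrt ((θ.d₆ + 1) * Fintype.card (TrIdx N))) ((θ.ℓ₆ + 1 : ℕ) : ℝ) θ12 θD12 θ2₁₂ r12 B12₀ B12₂ δ12₀ δK12 σ12 (max c12 0) ρ12 ρf12 a12 M12 ML12 B12₃ δ12₃ α12 ((θ.ℓ₆ + 1 : ℕ) : ℝ)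
      Bh12 Bi12 Bq12 θH12 θI12 Bi2₁₂ hθ12 hθD12 hθH12 hθI12 hθ2₁₂ hr12 hB12₀ hB12₂ hB12₃ hσ12.le hρ12 hρS12 hρδ12 hρ₃12 (le_max_right _ _) ha12 hM12 hα12' hα12.le hρf12 hρf1 hρf2 hBh12 hBi12 hBi2₁₂ hBq12
      (Real.sqrt_nonneg _) one_le_L_nat hgeoOK (fun x => modelSignsOn_geo9K x.toKIdx) (fun _ => hL1) (fun _ => le_rfl) one_le_L_nat hη hrow hL21 (hnbr_two_of_le hM₀)
      (fun x a a' h => len_le_of_dist_le_two_geo9Y x a a' h) hsat hmult hRdist hRlen hcoR12 hco1R12 hcoHR12 hcoG12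
      (fun x U => ⟨⟨(hDL x U).1, (hDL x U).2.1, (hDL x U).2.2, (hDL3 x U).1, (hDL3 x U).2.1, (hDL3 x U).2.2⟩, ⟨(h1L x U).1, (h1L x U).2.1, (h1L x U).2.2, (h1L3 x U).1, (h1L3 x U).2.1, (h1L3 x U).2.2⟩⟩)
      (fun x U => ⟨(hH1N x U).1, (hH1N x U).2.1⟩) (fun x U => ⟨(hIF x U).1, (hIF x U).2.1⟩) hHCN hsym12 hmodel12 hleft12 (fun x => weightNorm (BlockNorm.ofBlocks (toB6 (geo9Y x) 1 (H12 x)) (𝔬12 x).blkZ) (wZ x) (fun y => (hwZ x y).le)) (fun _ => rfl) hlettersH12 (fun x hM α₀ hα ha U hU hU' => ⟨(hG0C x hM α₀ hα ha U hU hU').1, (hG0C x hM α₀ hα ha U hU hU').2.2⟩) hstepC hLHH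
  · rw [hE, hK']
    exact thm313Printed_completePairMBCZc 𝔬12 (fun _ => 1) H12 (fun x => ((opsYNuOfRecordV4PE N θ Mstar 𝔯 𝔢 𝔴 𝔈) x).GG) bH13 𝔭A bHX12 Gp bXH Dd Dds bHW13 (fun x => evBK x.toKIdx) (fun x => evBK x.toKIdx) (fun x => RelB x.toKIdx) (2 * (θ.d₆ + 1)) (nbrCountY θ.d₆ θ.ℓ₆ θ.hd' θ.hL' θ.b₀ θ.b₁ 2)
      2 (Real.sqrt ((θ.d₆ + 1) * Fintype.card (TrIdx N))) ((θ.ℓ₆ + 1 : ℕ) : ℝ) θ12 θD12 θ2₁₂ r12 B12₀ B12₂ B13₄ δ12₀ δK12 σ12 (max c12 0) ρ12 a12 M12 ML12 B12₃ δ12₃ ρ13 α12 ((θ.ℓ₆ + 1 : ℕ) : ℝ) κ13 Bh12 Bi12 Bq12 BhD13 Bx13 Bd13 θH12 θI12 θV13 Br13 Bi2₁₂ Bd2₁₃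
      hθ12 hθD12 hθH12 hθI12 hθ2₁₂ hθV13 hr12 hB12₀ hB12₂ hB12₃ hB13₄ hBr13 hσ12.le hρ13 (by linarith only [hρ13ρ, hσ12]) hρ13ρ hσρ13 hρS12 (le_trans (by linarith only [hσ12]) hρ₃12) hρδ12 (le_max_right _ _) ha12 hM12 hα12.le hBi12 hBd13 hBi2₁₂ hBd2₁₃ hBh12 (fun β _ _ => hBq12 β) hBhD13 hBx13
      (Real.sqrt_nonneg _) one_le_L_nat hgeoOK (fun x => modelSignsOn_geo9K x.toKIdx) (fun _ => hL1) (fun _ => le_rfl) hη hκ13 hκW13 hκX hrow hL21 (hnbr_two_of_le hM₀) (fun x a a' h => len_le_of_dist_le_two_geo9Y x a a' h) hsat hmult hcoR13 hco1R13 hcoG13 hsym13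
      (fun x U => ⟨(hGL x U).1, (hGL x U).2.1, (hGL x U).2.2, (hGL3 x U).1, (hGL3 x U).2.1, (hGL3 x U).2.2⟩) (fun x U => (hH1N x U).2.2) (fun x U => (hIF x U).2.2) hRdist hmodel12 hleft12 wZ hwZ hletters13 h152 hlettersD13
      (fun x hM α₀ hα ha U hU hU' => ⟨(hG0C x hM α₀ hα ha U hU hU').1, (hG0C x hM α₀ hα ha U hU hU').2.1⟩) (fun x hM α₀ hα ha U hU hU' => (hstepC x hM α₀ hα ha U hU hU').1) hLHH hLH3
      (fun x hM α₀ hα ha U hU hU' => (hG0C x hM α₀ hα ha U hU hU').2.2) (fun x hM α₀ hα ha U hU hU' => (hstepC x hM α₀ hα ha U hU hU').2) vZ hvZ hLL2 hLIM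

end Pointed

end Summit.QuantumFields.YangMills.BalabanUVNodes.N06Thm312313AtPinsPairMBCZcP

end
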